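import Summits.ABC.ABC.Theorems.IneffectiveSubspaceUniformSadicTowerFourCellSettledHalf
import Literature.NumberTheory.DiophantineGeometry.ClassicalPellPowerFacts

/-!
# Bridge: Chen–Voutier's simplest quartic Thue theorem ⇒ Ljunggren 1942 (`x² + 1 = 2y⁴`)

The solved-zoo family (ii) of `SolvedZooABC` (stmt-ABC-24025) needs, besides `cohn1996_lemma_odd`
(★ p609304), Ljunggren's 1942 theorem: the only positive solutions of `x² + 1 = 2y⁴` are `(1, 1)` and
`(239, 13)` — typed by abc-harv-typ-1 as the cite-only named fact
`Literature.NumberTheory.DiophantineGeometry.ljunggren1942_sqPlusOneEqTwiceFourth`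
(`∀ x y : ℕ, 0 < x → 0 < y → x ^ 2 + 1 = 2 * y ^ 4 → (x = 1 ∧ y = 1) ∨ (x = 239 ∧ y = 13)`).
The tree ALREADY derives the `y`-part from another named fact: the four-cell wall's
`UniformSadicTowerFour.QuarticRootWall.ljunggren_of_simplestQuarticThue`
(`Summits/ABC/ABC/Theorems/IneffectiveSubspaceUniformSadicTowerFourCellSettledHalf.lean`) gives
`1 + t² = 2n⁴ ⇒ n ∈ {1, 13}` from `SimplestQuarticThueSolutions` (Chen Jian Hua – P. Voutier,
J. Number Theory 62 (1997) 71–99, Thm 3, the `t = 4` clause;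
`Literature/NumberTheory/DiophantineGeometry/SimplestQuarticThue.lean`). This file adds the five-line
bridge recovering `x` (`x² = 2y⁴ − 1 ∈ {1, 57121} ⇒ x ∈ {1, 239}`), so that ONE deep leaf serves both
consumers (abc-inputs audit INPUTS-LIST §7 pt 1; host desk g4 D1, 2026-08-28): the statement
`ljunggren1942_of_simplestQuarticThue` has EXACTLY the Prop text of the typed fact F1 as its conclusion,
so `ljunggren1942_sqPlusOneEqTwiceFourth_of_simplestQuarticThue hCV : ljunggren1942_sqPlusOneEqTwiceFourth`;
two adapters `quartic_root_eq_of_ljunggren1942` / `quartic_root_eq_of_simplestQuarticThue` produce the binder shape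
`∀ x t : ℕ, x ^ 2 + 1 = 2 * t ^ 4 → t = 1 ∨ t = 13` of the zoo consumer `SolvedZooL2Consumer.l2_params`.

PROOF-ONLY file (no definitions, no named facts, no `sorry`); CONDITIONAL on the named fact
`SimplestQuarticThueSolutions` AS TYPED (Chen–Voutier Thm 3 rests on Padé/hypergeometric machinery not in
the tree). Serves stmt-ABC-24025 `--supports … --as helper` without closing it. HONESTY: abc is not
touched (abc moved by 0; NOT abc); typed ≠ proved.
-/

-- `Summit.<Summit>.<Problem>` is the mandated summit-side namespace (CONVENTIONS §2); for the
-- single-conjunct summit `ABC` the two coincide, so the duplicate `ABC.ABC` is deliberate.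
set_option linter.dupNamespace false

namespace Summit.ABC.ABC.Theorems

open Literature.NumberTheory.DiophantineGeometry

/-- **Ljunggren 1942 from Chen–Voutier 1997 Thm 3** (conditional on the named fact
`SimplestQuarticThueSolutions`): the only positive solutions of `x² + 1 = 2·y⁴` are `(x, y) = (1, 1)` and
`(239, 13)`. The `y`-part is the tree's `UniformSadicTowerFour.QuarticRootWall.ljunggren_of_simplestQuarticThue`;
`x` is recovered from `x² = 2y⁴ − 1`. The conclusion is verbatim the Prop text of the typed fact
`ljunggren1942_sqPlusOneEqTwiceFourth` (abc-harv-typ-1). [cite: ChenVoutier1997, Thm 3] -/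
theorem ljunggren1942_of_simplestQuarticThue (hCV : SimplestQuarticThueSolutions) :
    ∀ x y : ℕ, 0 < x → 0 < y → x ^ 2 + 1 = 2 * y ^ 4 → (x = 1 ∧ y = 1) ∨ (x = 239 ∧ y = 13) := by
  intro x y _ _ h
  rcases UniformSadicTowerFour.QuarticRootWall.ljunggren_of_simplestQuarticThue hCV x y
      (by rw [add_comm]; exact h) with rfl | rfl
  · left
    refine ⟨?_, rfl⟩
    have hx : x ^ 2 = 1 ^ 2 := by omega
    exact Nat.pow_left_injective two_ne_zero hx
  · right
    refine ⟨?_, rfl⟩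
    have hx : x ^ 2 = 239 ^ 2 := by norm_num at h; omega
    exact Nat.pow_left_injective two_ne_zero hx

/-- **The typed fact F1 BY NAME from Chen–Voutier Thm 3:**
`SimplestQuarticThueSolutions → ljunggren1942_sqPlusOneEqTwiceFourth` (abc-harv-typ-1's
`Literature/NumberTheory/DiophantineGeometry/ClassicalPellPowerFacts.lean`, ★ p609632). One deep leaf,
two consumers (the four-cell wall and the solved zoo's family (ii)); use it to discharge the binder
`(hQuartic : ljunggren1942_sqPlusOneEqTwiceFourth)` of the zoo consumers modulo `SimplestQuarticThueSolutions`.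
[cite: ChenVoutier1997, Thm 3] -/
theorem ljunggren1942_sqPlusOneEqTwiceFourth_of_simplestQuarticThue (hCV : SimplestQuarticThueSolutions) :
    ljunggren1942_sqPlusOneEqTwiceFourth :=
  ljunggren1942_of_simplestQuarticThue hCV

/-- Adapter to the binder shape used by the zoo's family-(ii) consumer
(`SolvedZooL2Consumer.l2_params (hQuartic : ∀ x t : ℕ, x ^ 2 + 1 = 2 * t ^ 4 → t = 1 ∨ t = 13)`):
the typed fact F1 `ljunggren1942_sqPlusOneEqTwiceFourth` (positivity hypotheses, full solution list)
implies it — `t = 0` and `x = 0` are impossible in `x² + 1 = 2t⁴`. [cite: Ljunggren1942] -/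
theorem quartic_root_eq_of_ljunggren1942 (hF1 : ljunggren1942_sqPlusOneEqTwiceFourth) :
    ∀ x t : ℕ, x ^ 2 + 1 = 2 * t ^ 4 → t = 1 ∨ t = 13 := by
  intro x t h
  have ht : 0 < t := by
    rcases Nat.eq_zero_or_pos t with rfl | ht
    · simp at h
    · exact ht
  have hx : 0 < x := by
    rcases Nat.eq_zero_or_pos x with rfl | hx
    · have h4 : 1 ≤ t ^ 4 := Nat.one_le_pow _ _ ht
      omega
    · exact hx
  rcases hF1 x t hx ht h with ⟨-, h1⟩ | ⟨-, h13⟩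
  · exact Or.inl h1
  · exact Or.inr h13

/-- The same binder shape straight from Chen–Voutier Thm 3 (`add_comm` on the tree's
`UniformSadicTowerFour.QuarticRootWall.ljunggren_of_simplestQuarticThue`). [cite: ChenVoutier1997, Thm 3] -/
theorem quartic_root_eq_of_simplestQuarticThue (hCV : SimplestQuarticThueSolutions) :
    ∀ x t : ℕ, x ^ 2 + 1 = 2 * t ^ 4 → t = 1 ∨ t = 13 :=
  fun x t h => UniformSadicTowerFour.QuarticRootWall.ljunggren_of_simplestQuarticThue hCV x t
    (by rw [add_comm]; exact h)

end Summit.ABC.ABC.Theorems
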